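import Literature.Computability.Complexity.PolyExistsNTIMEPrograms
import HarnessLib

/-!
# The clock program of the `∃`-closure of `NSUBEXP`

Third of five files of the proof of `polyExists_NSUBEXP_subset_NSUBEXP` (`AaronsonVanMelkebeek2011.lean`).
The tree's truncating wrapper `truncMapAux N` (`TruncMapMachine.lean`) maps `⟨x, v⟩` to
`⟨a, v ↾ |u|⟩` whenever the machine `N` maps `x` to `⟨a, u⟩`, discarding the rest of `v` two
symbols per step. The new verifier uses it with the **clock** `N : x ↦ ⟨x, 1^{U(|x|)}⟩`, where

  `U(n) = 2 p(n) + 2 + (c' · 2^{⌊(2n + 2 + p(n))^{1/r'}⌋} + c')`        (`clockLen p r' c' n`)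

bounds the length of every honest witness `⟨y, z⟩ = SProg.dbl y ++ 0 1 z` (`|y| ≤ p(n)`, `z` a
certificate of the member `r'` of the `NSUBEXP` presentation of the inner language, with
constant `c'`, for the pair `⟨x, y⟩` of length `2n + 2 + |y|`). This file programs the clock as a
structured stack program `clockProg p r' c'` over the register file of
`PolyExistsNTIMEPrograms.lean` and proves its specification `runs_clockProg` with the explicit
cost `cClock p r' c' n`: split the input into a reversed copy and its unary length, evaluate
`p` by Horner, form `m = 2n + 2 + p(n)`, take the integer root, exponentiate by doubling, and
emit `1^U`, the separator and the doubled copy of `x` — i.e. the word `boolPair x (1^U)`.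

## References

* S. Arora, B. Barak, *Computational Complexity: A Modern Approach*, CUP 2009, §1.3 (machine
  constructions), Def. 2.1 (verifier form of nondeterministic time).
* T. Nipkow, G. Klein, *Concrete Semantics with Isabelle/HOL*, Springer 2014, Ch. 7.
-/

namespace Literature.Computability.Complexity

namespace PolyExistsNTIME

open ACom ExpPad

/-! ### The clock length -/

/-- **The clock length** `U(n) = 2 p(n) + 2 + (c' · 2^{⌊(2n+2+p(n))^{1/r'}⌋} + c')`: the longest
honest witness `dbl y ++ 0 1 z` of the new verifier. [folklore] -/
def clockLen (p : Polynomial ℕ) (r' c' n : ℕ) : ℕ :=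
  2 * p.eval n + 2 + (c' * 2 ^ Nat.nthRoot r' (2 * n + 2 + p.eval n) + c')

/-! ### Stage 1: split the input -/

/-- `split`: pop the input, pushing each symbol on `xr` and a token on `n`. [folklore] -/
def split : Prog := loop .inp fun b => push .xr b ;; push .n true

/-- Effect and cost of `split`. [folklore] -/
theorem runs_split (x : List Bool) :
    Runs split (mk x [] [] [] [] [] [] [] [] [] [] [] [])
      (mk [] x.reverse (un x.length) [] [] [] [] [] [] [] [] [] []) (4 * x.length + 1) := by
  have h := runs_loop_inv (k := Rg.inp) (f := fun b => push .xr b ;; push .n true)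
    (fun done rest => mk rest done (un done.length) [] [] [] [] [] [] [] [] [] [])
    (fun _ _ => True) 2
    (fun _ _ _ => rfl)
    (fun done a rest _ => ⟨trivial, by
      refine ((Runs.push' rfl).seq (Runs.push' ?_)).of_eq rfl (by norm_num)
      simp [un, List.replicate_succ]⟩)
    x [] trivial
  unfold split
  simpa using h

/-! ### Stage 2: the length `m = 2n + 2 + p(n)` -/

/-- `buildM`: `m := 1^{2|n| + 2 + |a|}`, consuming `n` and keeping `a` (via `t`). [folklore] -/
def buildM : Prog :=
  loop .n (fun _ => push .m true ;; push .m true) ;; push .m true ;; push .m true ;;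
  loop .a (fun _ => push .m true ;; push .t true) ;; pour .t .a

/-- Effect and cost of `buildM`. [folklore] -/
theorem runs_buildM (i xr s e f yr zr o : List Bool) (k P : ℕ) :
    Runs buildM (mk i xr (un k) (un P) [] [] [] s e f yr zr o)
      (mk i xr [] (un P) [] [] (un (2 * k + 2 + P)) s e f yr zr o) (4 * k + 7 * P + 5) := by
  have h1 := runs_loop_inv (k := Rg.n) (f := fun _ => push .m true ;; push .m true)
    (fun done rest => mk i xr rest (un P) [] [] (un (2 * done.length)) s e f yr zr o)
    (fun _ _ => True) 2
    (fun _ _ _ => rfl)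
    (fun done a rest _ => ⟨trivial, by
      refine ((Runs.push' rfl).seq (Runs.push' ?_)).of_eq rfl (by norm_num)
      simp [un, Nat.mul_succ, List.replicate_succ]⟩)
    (un k) [] trivial
  have h1' : Runs (loop Rg.n fun _ => push Rg.m true ;; push Rg.m true)
      (mk i xr (un k) (un P) [] [] [] s e f yr zr o) (mk i xr [] (un P) [] [] (un (2 * k)) s e f yr zr o)
      (4 * k + 1) := by
    simpa [un] using h1
  have h2 : Runs (push Rg.m true) (mk i xr [] (un P) [] [] (un (2 * k)) s e f yr zr o)
      (mk i xr [] (un P) [] [] (un (2 * k + 1)) s e f yr zr o) 1 := Runs.push' (by simp [un_succ])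
  have h3 : Runs (push Rg.m true) (mk i xr [] (un P) [] [] (un (2 * k + 1)) s e f yr zr o)
      (mk i xr [] (un P) [] [] (un (2 * k + 2)) s e f yr zr o) 1 := Runs.push' (by simp [un_succ])
  have h4 := runs_loop_inv (k := Rg.a) (f := fun _ => push .m true ;; push .t true)
    (fun done rest => mk i xr [] rest [] (un done.length) (un (done.length + (2 * k + 2))) s e f yr zr o)
    (fun _ _ => True) 2
    (fun _ _ _ => rfl)
    (fun done a rest _ => ⟨trivial, by
      refine ((Runs.push' rfl).seq (Runs.push' ?_)).of_eq rfl (by norm_num)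
      simp [un, List.replicate_succ, Nat.succ_add]⟩)
    (un P) [] trivial
  have h4' : Runs (loop Rg.a fun _ => push Rg.m true ;; push Rg.t true)
      (mk i xr [] (un P) [] [] (un (2 * k + 2)) s e f yr zr o)
      (mk i xr [] [] [] (un P) (un (P + (2 * k + 2))) s e f yr zr o) (4 * P + 1) := by
    simpa [un] using h4
  have h5 := runs_pour (Γ := Bool) (a := Rg.t) (b := Rg.a) (by decide)
    (mk i xr [] [] [] (un P) (un (P + (2 * k + 2))) s e f yr zr o)
  have h5' : Runs (pour Rg.t Rg.a) (mk i xr [] [] [] (un P) (un (P + (2 * k + 2))) s e f yr zr o)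
      (mk i xr [] (un P) [] [] (un (P + (2 * k + 2))) s e f yr zr o) (3 * P + 1) := by
    simpa [un] using h5
  have := h1'.seq (h2.seq (h3.seq (h4'.seq h5')))
  unfold buildM
  refine this.of_eq ?_ (by omega)
  rw [show P + (2 * k + 2) = 2 * k + 2 + P by omega]

/-! ### Stage 3: emitting the clock and the first component -/

/-- `emitU c'`: push `c' · |e| + c' + 2 |a| + 2` tokens on the output, consuming `e` and `a`.
[folklore] -/
def emitU (c' : ℕ) : Prog :=
  loop .e (fun _ => pushList .out (un c')) ;; pushList .out (un c') ;;
  loop .a (fun _ => push .out true ;; push .out true) ;; push .out true ;; push .out true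

/-- Effect and cost of `emitU`. [folklore] -/
theorem runs_emitU (c' : ℕ) (i xr m yr zr : List Bool) (P E : ℕ) :
    Runs (emitU c') (mk i xr [] (un P) [] [] m [] (un E) [] yr zr [])
      (mk i xr [] [] [] [] m [] [] [] yr zr (un (2 * P + 2 + (c' * E + c'))))
      ((c' + 2) * E + 1 + c' + (4 * P + 1) + 2) := by
  have h1 := runs_loop_inv (k := Rg.e) (f := fun _ => pushList .out (un c'))
    (fun done rest => mk i xr [] (un P) [] [] m [] rest [] yr zr (un (c' * done.length)))
    (fun _ _ => True) c'
    (fun _ _ _ => rfl)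
    (fun done a rest _ => ⟨trivial, by
      have := runs_pushList (Γ := Bool) Rg.out (un c')
        (mk i xr [] (un P) [] [] m [] rest [] yr zr (un (c' * done.length)))
      simp only [mk_out, update_mk_out, un, List.reverse_replicate, List.length_replicate,
        List.replicate_append_replicate] at this
      simp only [update_mk_e, List.length_cons, un]
      refine this.of_eq ?_ le_rfl
      rw [Nat.mul_succ, Nat.add_comm]⟩)
    (un E) [] trivial
  have h1' : Runs (loop Rg.e fun _ => pushList Rg.out (un c'))
      (mk i xr [] (un P) [] [] m [] (un E) [] yr zr []) (mk i xr [] (un P) [] [] m [] [] [] yr zr (un (c' * E)))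
      ((c' + 2) * E + 1) := by
    simpa [un] using h1
  have h2 := runs_pushList (Γ := Bool) Rg.out (un c') (mk i xr [] (un P) [] [] m [] [] [] yr zr (un (c' * E)))
  simp only [mk_out, update_mk_out, un, List.reverse_replicate, List.length_replicate,
    List.replicate_append_replicate] at h2
  have h2' : Runs (pushList Rg.out (un c')) (mk i xr [] (un P) [] [] m [] [] [] yr zr (un (c' * E)))
      (mk i xr [] (un P) [] [] m [] [] [] yr zr (un (c' * E + c'))) c' := by
    refine h2.of_eq ?_ le_rfl
    simp [un, Nat.add_comm]
  have h3 := runs_loop_inv (k := Rg.a) (f := fun _ => push .out true ;; push .out true)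
    (fun done rest => mk i xr [] rest [] [] m [] [] [] yr zr (un (2 * done.length + (c' * E + c'))))
    (fun _ _ => True) 2
    (fun _ _ _ => rfl)
    (fun done a rest _ => ⟨trivial, by
      refine ((Runs.push' rfl).seq (Runs.push' ?_)).of_eq rfl (by norm_num)
      have e1 : 2 * (done.length + 1) + (c' * E + c') = (2 * done.length + (c' * E + c')) + 1 + 1 := by
        ring
      simp [un, List.replicate_succ, e1]⟩)
    (un P) [] trivial
  have h3' : Runs (loop Rg.a fun _ => push Rg.out true ;; push Rg.out true)
      (mk i xr [] (un P) [] [] m [] [] [] yr zr (un (c' * E + c')))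
      (mk i xr [] [] [] [] m [] [] [] yr zr (un (2 * P + (c' * E + c')))) (4 * P + 1) := by
    simpa [un] using h3
  have h4 : Runs (push Rg.out true) (mk i xr [] [] [] [] m [] [] [] yr zr (un (2 * P + (c' * E + c'))))
      (mk i xr [] [] [] [] m [] [] [] yr zr (un (2 * P + (c' * E + c') + 1))) 1 :=
    Runs.push' (by simp [un_succ])
  have h5 : Runs (push Rg.out true) (mk i xr [] [] [] [] m [] [] [] yr zr (un (2 * P + (c' * E + c') + 1)))
      (mk i xr [] [] [] [] m [] [] [] yr zr (un (2 * P + (c' * E + c') + 2))) 1 :=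
    Runs.push' (by simp [un_succ])
  have := h1'.seq (h2'.seq (h3'.seq (h4.seq h5)))
  unfold emitU
  refine this.of_eq ?_ (by omega)
  rw [show 2 * P + (c' * E + c') + 2 = 2 * P + 2 + (c' * E + c') by omega]

/-- `emitX`: push the separator `1`, `0` and then every symbol of `xr` twice on the output
(building `boolPair x _` on top of the output). [folklore] -/
def emitX : Prog := push .out true ;; push .out false ;; loop .xr fun b => push .out b ;; push .out b

/-- Effect and cost of `emitX`: on `xr = x.reverse` and output `w` it leaves `boolPair x w`.
[folklore] -/
theorem runs_emitX (x m w : List Bool) :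
    Runs emitX (mk [] x.reverse [] [] [] [] m [] [] [] [] [] w)
      (mk [] [] [] [] [] [] m [] [] [] [] [] (boolPair x w)) (4 * x.length + 3) := by
  have h1 : Runs (push Rg.out true) (mk [] x.reverse [] [] [] [] m [] [] [] [] [] w)
      (mk [] x.reverse [] [] [] [] m [] [] [] [] [] (true :: w)) 1 := Runs.push' (by simp)
  have h2 : Runs (push Rg.out false) (mk [] x.reverse [] [] [] [] m [] [] [] [] [] (true :: w))
      (mk [] x.reverse [] [] [] [] m [] [] [] [] [] (false :: true :: w)) 1 := Runs.push' (by simp)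
  have h3 := runs_loop_inv (k := Rg.xr) (f := fun b => push .out b ;; push .out b)
    (fun done rest => mk [] rest [] [] [] [] m [] [] [] [] [] (SProg.dbl done ++ false :: true :: w))
    (fun _ _ => True) 2
    (fun _ _ _ => rfl)
    (fun done a rest _ => ⟨trivial, by
      refine ((Runs.push' rfl).seq (Runs.push' ?_)).of_eq rfl (by norm_num)
      simp⟩)
    x.reverse [] trivial
  have h3' : Runs (loop Rg.xr fun b => push Rg.out b ;; push Rg.out b)
      (mk [] x.reverse [] [] [] [] m [] [] [] [] [] (false :: true :: w))
      (mk [] [] [] [] [] [] m [] [] [] [] [] (boolPair x w)) (4 * x.length + 1) := by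
    simpa [boolPair_eq_dbl] using h3
  unfold emitX
  exact (h1.seq (h2.seq h3')).of_eq rfl (by omega)

/-! ### The clock program -/

/-- **The clock program**: `x ↦ boolPair x (1^{clockLen p r' c' |x|})`. [folklore] -/
noncomputable def clockProg (p : Polynomial ℕ) (r' c' : ℕ) : Prog :=
  split ;; horner (coeffList p) ;; buildM ;; push .e true ;; rootLoop r' ;; push .e true ;;
  (loop .s fun _ => dblE) ;; emitU c' ;; emitX ;; clear .m

/-- The length `m(n) = 2n + 2 + p(n)` of a maximal pair `⟨x, y⟩`. [folklore] -/
def lenM (p : Polynomial ℕ) (n : ℕ) : ℕ := 2 * n + 2 + p.eval n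

/-- The root `⌊m(n)^{1/r'}⌋`. [folklore] -/
def rootM (p : Polynomial ℕ) (r' n : ℕ) : ℕ := Nat.nthRoot r' (lenM p n)

/-- **Cost of the clock program** on inputs of length `n`. [folklore] -/
noncomputable def cClock (p : Polynomial ℕ) (r' c' n : ℕ) : ℕ :=
  (4 * n + 1) + cHorner n (coeffList p) + (4 * n + 7 * p.eval n + 5) + 1 +
  ((lenM p n + 2) * (cRootIter r' (lenM p n) + 2) + 1) + 1 + cExp (rootM p r' n) 1 +
  ((c' + 2) * 2 ^ rootM p r' n + 1 + c' + (4 * p.eval n + 1) + 2) + (4 * n + 3) + (2 * lenM p n + 1)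

/-- **Specification of the clock program** (`r' ≠ 0`): from the input store holding `x` to the
output store holding `boolPair x (1^{clockLen p r' c' |x|})`, within `cClock p r' c' |x|` steps.
[folklore] -/
theorem runs_clockProg (p : Polynomial ℕ) {r' : ℕ} (hr' : r' ≠ 0) (c' : ℕ) (x : List Bool) :
    Runs (clockProg p r' c') (AStore.single .inp x)
      (AStore.single .out (boolPair x (un (clockLen p r' c' x.length)))) (cClock p r' c' x.length) := by
  rw [single_inp, single_out]
  set n := x.length with hn
  set P := p.eval n with hP
  have h1 := runs_split x
  rw [← hn] at h1
  have h2 := runs_horner [] x.reverse [] [] [] [] [] [] [] n (coeffList p)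
  rw [hornerVal_coeffList, ← hP] at h2
  have h3 := runs_buildM [] x.reverse [] [] [] [] [] [] n P
  have h4 : Runs (push Rg.e true) (mk [] x.reverse [] (un P) [] [] (un (2 * n + 2 + P)) [] [] [] [] [] [])
      (mk [] x.reverse [] (un P) [] [] (un (2 * n + 2 + P)) [] [true] [] [] [] []) 1 := Runs.push' (by simp)
  have h5 := runs_root hr' [] x.reverse [] (un P) [] [] [] (2 * n + 2 + P)
  set s := Nat.nthRoot r' (2 * n + 2 + P) with hs
  have h6 : Runs (push Rg.e true) (mk [] x.reverse [] (un P) [] [] (un (2 * n + 2 + P)) (un s) [] [] [] [] [])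
      (mk [] x.reverse [] (un P) [] [] (un (2 * n + 2 + P)) (un s) (un 1) [] [] [] []) 1 :=
    Runs.push' (by simp [un])
  have h7 := runs_exp2 [] x.reverse [] (un P) [] [] (un (2 * n + 2 + P)) [] [] [] s 1
  rw [one_mul] at h7
  have h8 := runs_emitU c' [] x.reverse (un (2 * n + 2 + P)) [] [] P (2 ^ s)
  have h9 := runs_emitX x (un (2 * n + 2 + P)) (un (2 * P + 2 + (c' * 2 ^ s + c')))
  have h10 := runs_clear (Γ := Bool) Rg.m
    (mk [] [] [] [] [] [] (un (2 * n + 2 + P)) [] [] [] [] [] (boolPair x (un (2 * P + 2 + (c' * 2 ^ s + c')))))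
  simp only [mk_m, update_mk_m, un, List.length_replicate] at h10
  have := h1.seq (h2.seq (h3.seq (h4.seq (h5.seq (h6.seq (h7.seq (h8.seq (h9.seq h10))))))))
  unfold clockProg
  refine this.of_eq ?_ ?_
  · simp [clockLen, ← hP, ← hs, un]
  · simp only [cClock, lenM, rootM, ← hP, ← hs]
    omega

end PolyExistsNTIME

end Literature.Computability.Complexity
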